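import Literature.AlgebraicGeometry.Morphisms.CechUnitCocycleModelTower
import Literature.AlgebraicGeometry.Motives.ThickeningLevelsComplex
import Literature.AlgebraicGeometry.Motives.PoincareUniversal.GraphCondition
import Literature.AlgebraicGeometry.Motives.AbsoluteFlatModelTransition
import Literature.AlgebraicGeometry.Motives.ThickeningArtinianPoints
import Literature.AlgebraicGeometry.Motives.SmoothThickeningLift
import Literature.AlgebraicGeometry.AbelianSchemes.ModuleSliceOfBaseChange
import HarnessLib

/-!
# M13 — the model tower of `(A₀, Θ, 𝒫, T, ℒ, t)`: thickenings, restricted bundles, Artinian charts of `Â`, inputs, tower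

The M13 INSTANCE of the AV-free unit-cocycle calculus (`Morphisms/CechUnitCocycle*`) along [MumfordAV1970] §13 (proof of the
Theorem, pp. 125–130: «by induction on `n`, a morphism `Spec 𝒪_{T,t}/𝔪^{n+1} → X̂` with the graph condition»), for `A₀/ℂ` with
ample `Θ`, `𝒫` on `A₀ × Â` (`Â = A₀.dualOf Θ hΘ`), a test scheme `T/ℂ`, a rigidified line bundle `ℒ` on `A₀ × T`, `t ∈ T`:
the thickenings `Yn n = A₀ × Spec(𝒪_{T,t}/𝔪^{n+1})` ([GortzWedhorn2023] Lemma 24.72) with covers `Wn V n = pr⁻¹V`, transitions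
`τn`, restrictions `rn`, bundles `Ln n = ℒ|_{Yn n}`, `Lτn`; the LEVEL-INDEXED ARTINIAN CHARTS of `Â` at a closed `y₀`
(`sB/YBn/jBn/PBn = 𝒫|_{A₀ × Spec 𝒪_{Â,y₀}/𝔪^{n+1}}`), classifying maps `gφn/uφn/ptn` of a chart point
`φ : 𝒪_{Â,y₀}/𝔪^{m+1} → 𝒪_{T,t}/𝔪^{n+1}` (via `absTransition`), `chartIso`, `ptn_comp_β`; `GammaInputs` (frames of `ℒ|`/`𝒫|` on the
Artinian levels, a framed level-`0` graph point, lifts of chart points) and **`modelTower : ModelTower₂ A₀.X.hom V`** over the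
levels `Rt/πℂ/ρℂ/eℂ` (`Motives.ThickeningLevelsComplex`) and `absModelData`; Graph ⟹ `GraphCond` (`graphCond_of_iso`, ★
`PoincareUniversal.GraphCondition`); lifts of chart points from smoothness of `Â` (`exists_lift_chartPoint`: ★
`exists_thickeningPtTransition_comp_eq` + `artinianFactor`/`algHom_thickRing_ext`); the level-indexed lift model with injective
Kodaira–Spencer maps and the graph condition FROM THE INPUTS (`exists_liftModel₂_of_inputs`/`_of_frames_base`).
Cell `hodgecm-mathlib`, M13 node N3 (3c); source B-p20 (g7) v4 231f040e §§ Gamma/GammaInstance, cut B-p20 (g8).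
HC_CM is proved only modulo the 7 printed citations until rung 0 closes.

## References
* [MumfordAV1970] D. Mumford, *Abelian Varieties*, §13 (proof of the Thm. pp. 125–130).
* [GortzWedhorn2023] U. Görtz, T. Wedhorn, *Algebraic Geometry II*, Lemma 24.72 (p. 409) and its proof, Step (I) (p. 410).
-/

noncomputable section

universe u v

open TensorProduct CategoryTheory AlgebraicGeometry
open Literature.RingTheory.Flat Literature.RingTheory.Flat.IsSmallExtension

namespace Literature.AlgebraicGeometry.Motives.AbelianVariety

open CategoryTheory CategoryTheory.Limits AlgebraicGeometry MonoidalCategory CartesianMonoidalCategory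
open Literature.AlgebraicGeometry.AbelianSchemes Literature.AlgebraicGeometry.AbelianVarieties
  Literature.AlgebraicGeometry.Modules Literature.AlgebraicGeometry.Morphisms
  Literature.AlgebraicGeometry.Morphisms.CechUnitCocycle IsLocalRing

section Gamma

variable (A₀ : AbelianVariety ℂ) {Θ : CartierDivisor A₀.X.left} (hΘ : Θ.IsAmple)
  (P : (A₀.X ⊗ (A₀.dualOf Θ hΘ).X).left.Modules)
  (T' : SchemeOver ℂ) (ℒ : (AbelianSchemeOver.ofAbelianVariety A₀).RigidifiedLineBundle T'.hom) (t : T'.left)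

/-! ### The thickenings `Y n = A₀ × Spec 𝒪_{T,t}/𝔪^{n+1}` and the restricted bundles `L n` -/

/-- `Y n := A₀ × Spec(𝒪_{T,t}/𝔪^{n+1})` (the scheme carrying `ℒ|` at level `n`). [cite: GortzWedhorn2023, Lemma 24.72 (p. 409), proof, Step (I) (p. 410)] -/
abbrev Yn (n : ℕ) : Scheme := pullback A₀.X.hom (thickeningPt T' t n).hom

variable {A₀ T' t} in
/-- The covering family `pr⁻¹(V a)` of `Y n`. [folklore] -/
abbrev Wn {ι : Type} (V : ι → A₀.X.left.Opens) (n : ℕ) (a : ι) : (Yn A₀ T' t n).Opens :=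
  (pullback.fst A₀.X.hom (thickeningPt T' t n).hom) ⁻¹ᵁ (V a)

/-- The transition `Y n → Y (n+1)` (`1 × (Spec 𝒪/𝔪^{n+1} ↪ Spec 𝒪/𝔪^{n+2})`). [folklore] -/
def τn (n : ℕ) : Yn A₀ T' t n ⟶ Yn A₀ T' t (n + 1) := (A₀.X ◁ thickeningPtTransition T' t n).left

/-- The restriction map `Y n → A₀ × T` (`1 × (Spec 𝒪/𝔪^{n+1} → T)`). [folklore] -/
def rn (n : ℕ) : Yn A₀ T' t n ⟶ pullback A₀.X.hom T'.hom := (A₀.X ◁ thickeningPtι T' t n).left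

/-- `τ n ≫ r (n+1) = r n`. [cite: GortzWedhorn2023, Lemma 24.72 (p. 409), proof, Step (I) (p. 410)] -/
theorem τn_rn (n : ℕ) : τn A₀ T' t n ≫ rn A₀ T' t (n + 1) = rn A₀ T' t n := by
  change (A₀.X ◁ thickeningPtTransition T' t n ≫ A₀.X ◁ thickeningPtι T' t (n + 1)).left = _
  rw [← MonoidalCategory.whiskerLeft_comp, thickeningPtTransition_comp]
  rfl

/-- `L n := ℒ|_{Y n}`. [folklore] -/
def Ln (n : ℕ) : (Yn A₀ T' t n).Modules := (Scheme.Modules.pullback (rn A₀ T' t n)).obj ℒ.L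

/-- `(τ n)^* L (n+1) ≅ L n`. [folklore] -/
def Lτn (n : ℕ) : (Scheme.Modules.pullback (τn A₀ T' t n)).obj (Ln A₀ T' ℒ t (n + 1)) ≅ Ln A₀ T' ℒ t n :=
  ((Scheme.Modules.pullbackComp (τn A₀ T' t n) (rn A₀ T' t (n + 1))).app ℒ.L) ≪≫
    eqToIso (congrArg (fun k => (Scheme.Modules.pullback k).obj ℒ.L) (τn_rn A₀ T' t n))

end Gamma

section GammaInstance

variable (A₀ : AbelianVariety ℂ) {Θ : CartierDivisor A₀.X.left} (hΘ : Θ.IsAmple)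
  (P : (A₀.X ⊗ (A₀.dualOf Θ hΘ).X).left.Modules)
  (T' : SchemeOver ℂ) (ℒ : (AbelianSchemeOver.ofAbelianVariety A₀).RigidifiedLineBundle T'.hom)
  (t : T'.left) [LocallyOfFiniteType T'.hom] [IsLocallyNoetherian T'.left] (ht : IsClosed ({t} : Set T'.left))
  {ι : Type} (V : ι → A₀.X.left.Opens) (hV : ∀ a, IsAffineOpen (V a))
  (y₀ : (A₀.dualOf Θ hΘ).X.left) [LocallyOfFiniteType (A₀.dualOf Θ hΘ).X.hom]
  [IsLocallyNoetherian (A₀.dualOf Θ hΘ).X.left] (hy₀ : IsClosed ({y₀} : Set (A₀.dualOf Θ hΘ).X.left))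
  [IsSeparated A₀.X.hom]

/-- The base morphism of the `n`-th thickening of `T` at `t`. [folklore] -/
abbrev sT (n : ℕ) : Spec (CommRingCat.of (Rt T' t n)) ⟶ Spec (CommRingCat.of ℂ) := (thickeningPt T' t n).hom

/-- The base morphism of the `n`-th ARTINIAN CHART of `Â` at `y₀`. [folklore] -/
abbrev sB (n : ℕ) : Spec (CommRingCat.of (Rt (A₀.dualOf Θ hΘ).X y₀ n)) ⟶ Spec (CommRingCat.of ℂ) :=
  (thickeningPt (A₀.dualOf Θ hΘ).X y₀ n).hom

/-- The chart thickening `YB n := A₀ × Spec 𝒪_{Â,y₀}/𝔪^{n+1}`. [folklore] -/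
abbrev YBn (n : ℕ) : Scheme := pullback A₀.X.hom (sB A₀ hΘ y₀ n)

/-- `YB n → A₀ × Â`. [folklore] -/
def jBn (n : ℕ) : YBn A₀ hΘ y₀ n ⟶ (A₀.X ⊗ (A₀.dualOf Θ hΘ).X).left :=
  (A₀.X ◁ thickeningPtι (A₀.dualOf Θ hΘ).X y₀ n).left

/-- The chart bundle `PB n := 𝒫|_{YB n}`. [folklore] -/
def PBn (n : ℕ) : (YBn A₀ hΘ y₀ n).Modules := (Scheme.Modules.pullback (jBn A₀ hΘ y₀ n)).obj P

/-- The classifying map `Y n → YB m` of a chart point `φ : 𝒪_{Â,y₀}/𝔪^{m+1} → 𝒪_{T,t}/𝔪^{n+1}`. [folklore] -/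
def gφn (n m : ℕ) (φ : Rt (A₀.dualOf Θ hΘ).X y₀ m →ₐ[ℂ] Rt T' t n) : Yn A₀ T' t n ⟶ YBn A₀ hΘ y₀ m :=
  absTransition A₀.X (sB A₀ hΘ y₀ m) (thickeningPt_hom_eq (A₀.dualOf Θ hΘ).X y₀ m) (sT T' t n)
    (thickeningPt_hom_eq T' t n) φ

/-- The chart point as a morphism of `ℂ`-schemes `Spec 𝒪_{T,t}/𝔪^{n+1} → Spec 𝒪_{Â,y₀}/𝔪^{m+1}`. [folklore] -/
def uφn (n m : ℕ) (φ : Rt (A₀.dualOf Θ hΘ).X y₀ m →ₐ[ℂ] Rt T' t n) :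
    thickeningPt T' t n ⟶ thickeningPt (A₀.dualOf Θ hΘ).X y₀ m :=
  Over.homMk (Spec.map (CommRingCat.ofHom φ.toRingHom))
    (Spec_map_comp_eq_of_algHom (sB A₀ hΘ y₀ m) (thickeningPt_hom_eq (A₀.dualOf Θ hΘ).X y₀ m) (sT T' t n)
      (thickeningPt_hom_eq T' t n) φ)

omit [LocallyOfFiniteType T'.hom] [IsLocallyNoetherian T'.left] [LocallyOfFiniteType (A₀.dualOf Θ hΘ).X.hom]
  [IsLocallyNoetherian (A₀.dualOf Θ hΘ).X.left] [IsSeparated A₀.X.hom] in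
/-- `gφ = (A₀ ◁ uφ).left`. [cite: MumfordAV1970, §13 (proof of the Thm. pp. 125–130)] -/
theorem gφn_eq (n m : ℕ) (φ : Rt (A₀.dualOf Θ hΘ).X y₀ m →ₐ[ℂ] Rt T' t n) :
    (A₀.X ◁ uφn A₀ hΘ T' t y₀ n m φ).left = gφn A₀ hΘ T' t y₀ n m φ :=
  whiskerLeft_left_eq_absTransition A₀.X (sB A₀ hΘ y₀ m) (thickeningPt_hom_eq (A₀.dualOf Θ hΘ).X y₀ m)
    (sT T' t n) (thickeningPt_hom_eq T' t n) φ (uφn A₀ hΘ T' t y₀ n m φ) rfl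

/-- The chart point `Spec 𝒪_{T,t}/𝔪^{n+1} → Â` over `ℂ`. [folklore] -/
def ptn (n m : ℕ) (φ : Rt (A₀.dualOf Θ hΘ).X y₀ m →ₐ[ℂ] Rt T' t n) : thickeningPt T' t n ⟶ (A₀.dualOf Θ hΘ).X :=
  uφn A₀ hΘ T' t y₀ n m φ ≫ thickeningPtι (A₀.dualOf Θ hΘ).X y₀ m

omit [LocallyOfFiniteType T'.hom] [IsLocallyNoetherian T'.left] [LocallyOfFiniteType (A₀.dualOf Θ hΘ).X.hom]
  [IsLocallyNoetherian (A₀.dualOf Θ hΘ).X.left] [IsSeparated A₀.X.hom] in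
/-- `gφ ≫ jB = (A₀ ◁ pt).left`. [cite: MumfordAV1970, §13 (proof of the Thm. pp. 125–130)] -/
theorem gφn_jBn (n m : ℕ) (φ : Rt (A₀.dualOf Θ hΘ).X y₀ m →ₐ[ℂ] Rt T' t n) :
    gφn A₀ hΘ T' t y₀ n m φ ≫ jBn A₀ hΘ y₀ m = (A₀.X ◁ ptn A₀ hΘ T' t y₀ n m φ).left := by
  rw [← gφn_eq, jBn, ptn, MonoidalCategory.whiskerLeft_comp, Over.comp_left]
  rfl

/-- **The two chart presentations agree**: `(gφ n φ)^*𝒫|_{YB m} ≅ (gφ)^*𝒫|_{YB m'}` whenever the points of `Â`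
agree. [folklore] -/
def chartIso (n m m' : ℕ) (φ : Rt (A₀.dualOf Θ hΘ).X y₀ m →ₐ[ℂ] Rt T' t n)
    (φ' : Rt (A₀.dualOf Θ hΘ).X y₀ m' →ₐ[ℂ] Rt T' t n)
    (h : ptn A₀ hΘ T' t y₀ n m φ = ptn A₀ hΘ T' t y₀ n m' φ') :
    (Scheme.Modules.pullback (gφn A₀ hΘ T' t y₀ n m φ)).obj (PBn A₀ hΘ P y₀ m) ≅
      (Scheme.Modules.pullback (gφn A₀ hΘ T' t y₀ n m' φ')).obj (PBn A₀ hΘ P y₀ m') :=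
  ((Scheme.Modules.pullbackComp (gφn A₀ hΘ T' t y₀ n m φ) (jBn A₀ hΘ y₀ m)).app P) ≪≫
    eqToIso (congrArg (fun k => (Scheme.Modules.pullback k).obj P)
      (by rw [gφn_jBn, gφn_jBn, h])) ≪≫
    ((Scheme.Modules.pullbackComp (gφn A₀ hΘ T' t y₀ n m' φ') (jBn A₀ hΘ y₀ m')).app P).symm

omit [LocallyOfFiniteType T'.hom] [IsLocallyNoetherian T'.left] [LocallyOfFiniteType (A₀.dualOf Θ hΘ).X.hom]
  [IsLocallyNoetherian (A₀.dualOf Θ hΘ).X.left] [IsSeparated A₀.X.hom] in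
/-- `pt (φ ∘ β m) = pt φ`: composing a chart point with the chart reduction does not change the point of `Â`.
[cite: MumfordAV1970, §13 (proof of the Thm. pp. 125–130)] -/
theorem ptn_comp_β (n m : ℕ) (φ : Rt (A₀.dualOf Θ hΘ).X y₀ m →ₐ[ℂ] Rt T' t n) :
    ptn A₀ hΘ T' t y₀ n (m + 1) (φ.comp (πℂ (A₀.dualOf Θ hΘ).X y₀ m)) = ptn A₀ hΘ T' t y₀ n m φ := by
  apply (Over.forget _).map_injective
  change (Spec.map (CommRingCat.ofHom (φ.comp (πℂ (A₀.dualOf Θ hΘ).X y₀ m)).toRingHom)) ≫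
      (thickeningPtι (A₀.dualOf Θ hΘ).X y₀ (m + 1)).left =
    Spec.map (CommRingCat.ofHom φ.toRingHom) ≫ (thickeningPtι (A₀.dualOf Θ hΘ).X y₀ m).left
  have : CommRingCat.ofHom (φ.comp (πℂ (A₀.dualOf Θ hΘ).X y₀ m)).toRingHom =
      CommRingCat.ofHom (πℂ (A₀.dualOf Θ hΘ).X y₀ m).toRingHom ≫ CommRingCat.ofHom φ.toRingHom := rfl
  have h2 : (thickeningPtTransition (A₀.dualOf Θ hΘ).X y₀ m).left ≫ (thickeningPtι (A₀.dualOf Θ hΘ).X y₀ (m + 1)).left =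
      (thickeningPtι (A₀.dualOf Θ hΘ).X y₀ m).left :=
    congrArg CommaMorphism.left (thickeningPtTransition_comp (A₀.dualOf Θ hΘ).X y₀ m)
  rw [this]
  erw [Spec.map_comp]
  rw [Category.assoc, specMap_πℂ]
  exact congrArg (fun k => Spec.map (CommRingCat.ofHom φ.toRingHom) ≫ k) h2

/-- **THE REMAINING INPUTS of the M13 model tower** (what is still open, as DATA + Props): frames of `ℒ|_{Y n}` and
of `𝒫|_{YB n}` on the preimage cover (γ4-Nak: nilpotent Nakayama), a framed graph point at level `0` (γ6: ★
`exists_unique_classify_of_normal` at `Spec κ(t)`), and lifts of graph chart points (γ7: N3b + α7). Plumbing structure,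
no axioms. [cite: MumfordAV1970, §13 (proof of the Thm. pp. 125–130)] -/
structure GammaInputs where
  /-- frames of `ℒ|_{A₀ × Spec 𝒪_{T,t}/𝔪^{n+1}}` on `pr⁻¹V` -/
  FL : ∀ n, IFrames (Ln A₀ T' ℒ t n) (Wn V n)
  /-- frames of `𝒫|_{A₀ × Spec 𝒪_{Â,y₀}/𝔪^{n+1}}` on `pr⁻¹V` -/
  FP : ∀ n, IFrames (PBn A₀ hΘ P y₀ n) (fun a => (pullback.fst A₀.X.hom (sB A₀ hΘ y₀ n)) ⁻¹ᵁ V a)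
  /-- a framed graph point at level `0` lying over `y₀` -/
  base : ∃ φ₀ : Rt (A₀.dualOf Θ hΘ).X y₀ 0 →ₐ[ℂ] Rt T' t 0,
    Nonempty ((Scheme.Modules.pullback (gφn A₀ hΘ T' t y₀ 0 0 φ₀)).obj (PBn A₀ hΘ P y₀ 0) ≅ Ln A₀ T' ℒ t 0) ∧
      (ρℂ T' t ht 0).comp φ₀ = ρℂ (A₀.dualOf Θ hΘ).X y₀ hy₀ 0
  /-- graph chart points lift one level up -/
  lift : ∀ n (φ : Rt (A₀.dualOf Θ hΘ).X y₀ n →ₐ[ℂ] Rt T' t n),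
    Nonempty ((Scheme.Modules.pullback (gφn A₀ hΘ T' t y₀ n n φ)).obj (PBn A₀ hΘ P y₀ n) ≅ Ln A₀ T' ℒ t n) →
      ∃ φ' : Rt (A₀.dualOf Θ hΘ).X y₀ (n + 1) →ₐ[ℂ] Rt T' t (n + 1),
        (πℂ T' t n).comp φ' = φ.comp (πℂ (A₀.dualOf Θ hΘ).X y₀ n)

/-- **THE M13 MODEL TOWER.** [cite: MumfordAV1970, §13 (proof of the Thm. pp. 125–130)] -/
def modelTower (hcov : iSup V = ⊤) (G : GammaInputs A₀ hΘ P T' ℒ t ht V y₀ hy₀) : ModelTower₂ A₀.X.hom V where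
  R := Rt T' t
  commRing := inferInstance
  algebra := inferInstance
  π := πℂ T' t
  ρ := ρℂ T' t ht
  I n := thickKer T' (topPt T' t) n
  d n := thickDim T' (topPt T' t) n
  e := eℂ T' t ht
  small := level_isSmallExtension T' t ht
  hρ := ρℂ_comp_πℂ T' t ht
  Y := Yn A₀ T' t
  W := Wn V
  hW n := by
    change ⨆ a, (pullback.fst A₀.X.hom (thickeningPt T' t n).hom) ⁻¹ᵁ V a = ⊤
    rw [← Scheme.Hom.preimage_iSup, hcov, Scheme.Hom.preimage_top]
  Φ n := absModelData A₀.X (sT T' t n) (thickeningPt_hom_eq T' t n) V hV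
  τ := τn A₀ T' t
  homτ n := by
    have h := absModelData_hom A₀.X (sT T' t (n + 1)) (thickeningPt_hom_eq T' t (n + 1)) (sT T' t n)
      (thickeningPt_hom_eq T' t n) (πℂ T' t n) V hV
    have e : τn A₀ T' t n = absTransition A₀.X (sT T' t (n + 1)) (thickeningPt_hom_eq T' t (n + 1)) (sT T' t n)
        (thickeningPt_hom_eq T' t n) (πℂ T' t n) :=
      whiskerLeft_left_eq_absTransition A₀.X _ _ _ _ (πℂ T' t n) (thickeningPtTransition T' t n)
        (specMap_πℂ T' t n).symm
    rw [show τn A₀ T' t n = _ from e]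
    exact h
  L := Ln A₀ T' ℒ t
  FL := G.FL
  Lτ := Lτn A₀ T' ℒ t
  B := Rt (A₀.dualOf Θ hΘ).X y₀
  commRingB := inferInstance
  algebraB := inferInstance
  β := πℂ (A₀.dualOf Θ hΘ).X y₀
  ev := ρℂ (A₀.dualOf Θ hΘ).X y₀ hy₀
  hev := ρℂ_comp_πℂ (A₀.dualOf Θ hΘ).X y₀ hy₀
  YB := YBn A₀ hΘ y₀
  WB n a := (pullback.fst A₀.X.hom (sB A₀ hΘ y₀ n)) ⁻¹ᵁ V a
  ΦB n := absModelData A₀.X (sB A₀ hΘ y₀ n) (thickeningPt_hom_eq (A₀.dualOf Θ hΘ).X y₀ n) V hV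
  PB := PBn A₀ hΘ P y₀
  FP := G.FP
  gφ n φ := gφn A₀ hΘ T' t y₀ n n φ
  homφ n φ := absModelData_hom A₀.X _ _ _ _ φ V hV
  gUp n φ := gφn A₀ hΘ T' t y₀ n (n + 1) (φ.comp (πℂ (A₀.dualOf Θ hΘ).X y₀ n))
  homUp n φ := absModelData_hom A₀.X _ _ _ _ _ V hV
  chartUp n φ := chartIso A₀ hΘ P T' t y₀ n n (n + 1) φ _ (ptn_comp_β A₀ hΘ T' t y₀ n n φ).symm
  base := G.base
  lift := G.lift

/-! ### Graph ⟹ GraphCond, and the v2 socket from the inputs -/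

omit [LocallyOfFiniteType T'.hom] [IsLocallyNoetherian T'.left] [LocallyOfFiniteType (A₀.dualOf Θ hΘ).X.hom]
  [IsLocallyNoetherian (A₀.dualOf Θ hΘ).X.left] [IsSeparated A₀.X.hom] in
/-- `restrictAlong (ι, g) = r n` (the restriction map only sees the `T`-coordinate). [cite: MumfordAV1970, §13 (proof of the Thm. pp. 125–130)] -/
theorem restrictAlong_lift_ptn (n m : ℕ) (φ : Rt (A₀.dualOf Θ hΘ).X y₀ m →ₐ[ℂ] Rt T' t n) :
    restrictAlong A₀ hΘ T' (CartesianMonoidalCategory.lift (thickeningPtι T' t n) (ptn A₀ hΘ T' t y₀ n m φ)) =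
      rn A₀ T' t n := by
  unfold restrictAlong rn
  apply pullback.hom_ext
  · rw [pullback.lift_fst]
    exact (Over.whiskerLeft_left_fst (R := A₀.X) (thickeningPtι T' t n)).symm
  · rw [pullback.lift_snd]
    rw [CartesianMonoidalCategory.lift_fst]
    exact (Over.whiskerLeft_left_snd (R := A₀.X) (thickeningPtι T' t n)).symm

omit [LocallyOfFiniteType T'.hom] [IsLocallyNoetherian T'.left] [LocallyOfFiniteType (A₀.dualOf Θ hΘ).X.hom]
  [IsLocallyNoetherian (A₀.dualOf Θ hΘ).X.left] [IsSeparated A₀.X.hom] in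
/-- The left module of `GraphCond (ι, pt φ)` is the pull-back of `𝒫` along `gφ ≫ jB`. [cite: MumfordAV1970, §13 (proof of the Thm. pp. 125–130)] -/
theorem baseChangeToProd_lift_ptn (n m : ℕ) (φ : Rt (A₀.dualOf Θ hΘ).X y₀ m →ₐ[ℂ] Rt T' t n) :
    (AbelianSchemeOver.ofAbelianVariety A₀).baseChangeToProd (AbelianSchemeOver.ofAbelianVariety (A₀.dualOf Θ hΘ))
        (thickeningPt T' t n).hom
        ((CartesianMonoidalCategory.lift (thickeningPtι T' t n) (ptn A₀ hΘ T' t y₀ n m φ)) ≫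
          CartesianMonoidalCategory.snd _ _).left
        (Over.w _) =
      gφn A₀ hΘ T' t y₀ n m φ ≫ jBn A₀ hΘ y₀ m := by
  rw [AbelianSchemeOver.baseChangeToProd_ofAbelianVariety_eq_whiskerLeft_left, gφn_jBn,
    CartesianMonoidalCategory.lift_snd]

omit [LocallyOfFiniteType T'.hom] [IsLocallyNoetherian T'.left] [LocallyOfFiniteType (A₀.dualOf Θ hΘ).X.hom]
  [IsLocallyNoetherian (A₀.dualOf Θ hΘ).X.left] [IsSeparated A₀.X.hom] in
/-- **Graph ⟹ GraphCond**: an isomorphism `(gφ)^*𝒫|_{YB m} ≅ ℒ|_{Y n}` gives the graph condition of the chart point.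
[cite: MumfordAV1970, §13 (proof of the Thm. p. 125)] -/
theorem graphCond_of_iso (n m : ℕ) (φ : Rt (A₀.dualOf Θ hΘ).X y₀ m →ₐ[ℂ] Rt T' t n)
    (ψ : (Scheme.Modules.pullback (gφn A₀ hΘ T' t y₀ n m φ)).obj (PBn A₀ hΘ P y₀ m) ≅ Ln A₀ T' ℒ t n) :
    GraphCond A₀ hΘ P T' ℒ (CartesianMonoidalCategory.lift (thickeningPtι T' t n) (ptn A₀ hΘ T' t y₀ n m φ)) := by
  refine ⟨eqToIso (congrArg (fun k => (Scheme.Modules.pullback k).obj P) (baseChangeToProd_lift_ptn A₀ hΘ T' t y₀ n m φ)) ≪≫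
    ((Scheme.Modules.pullbackComp (gφn A₀ hΘ T' t y₀ n m φ) (jBn A₀ hΘ y₀ m)).app P).symm ≪≫ ψ ≪≫
    eqToIso (congrArg (fun k => (Scheme.Modules.pullback k).obj ℒ.L) (restrictAlong_lift_ptn A₀ hΘ T' t y₀ n m φ).symm)⟩

/-! ### (γ7) the `lift` input from smoothness of `Â` (★ N3b) and the Artinian factorisation (α7/α7′) -/

omit [LocallyOfFiniteType T'.hom] [IsLocallyNoetherian T'.left] [LocallyOfFiniteType (A₀.dualOf Θ hΘ).X.hom]
  [IsLocallyNoetherian (A₀.dualOf Θ hΘ).X.left] [IsSeparated A₀.X.hom] in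
/-- **(γ7) CHART POINTS LIFT ONE LEVEL UP**: every `ℂ`-algebra map `φ : 𝒪_{Â,y₀}/𝔪^{n+1} → 𝒪_{T,t}/𝔪^{n+1}` lifts to
`φ' : 𝒪_{Â,y₀}/𝔪^{n+2} → 𝒪_{T,t}/𝔪^{n+2}` with `π_T ∘ φ' = φ ∘ π_Â` — Mumford's «since `X̂` is non-singular, the
`R`-valued point lifts to an `R'`-valued point»: the `Over`-morphism `pt φ : Spec(𝒪_{T,t}/𝔪^{n+1}) → Â` extends along
the thickening by ★ `AbelianVariety.exists_thickeningPtTransition_comp_eq` (smoothness of `Â`), the extension factors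
through `Spec(𝒪_{Â,y₀}/𝔪^{n+2})` by the Artinian factorisation (α7 `artinianFactor`), and the compatibility is the
extensionality of chart points (α7′ `algHom_thickRing_ext`). [cite: MumfordAV1970, §13 (proof of the Thm. p. 125)] -/
theorem exists_lift_chartPoint (n : ℕ) (φ : Rt (A₀.dualOf Θ hΘ).X y₀ n →ₐ[ℂ] Rt T' t n) :
    ∃ φ' : Rt (A₀.dualOf Θ hΘ).X y₀ (n + 1) →ₐ[ℂ] Rt T' t (n + 1),
      (πℂ T' t n).comp φ' = φ.comp (πℂ (A₀.dualOf Θ hΘ).X y₀ n) := by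
  obtain ⟨g', hg'⟩ := AbelianVariety.exists_thickeningPtTransition_comp_eq T' t (A₀.dualOf Θ hΘ) n
    (ptn A₀ hΘ T' t y₀ n n φ)
  have hg'l : (thickeningPtTransition T' t n).left ≫ g'.left = (ptn A₀ hΘ T' t y₀ n n φ).left :=
    congrArg CommaMorphism.left hg'
  haveI : IsLocalRing (Rt T' t (n + 1)) := isLocalRing_thickRing T' (topPt T' t) (n + 1)
  haveI : IsLocalRing (Rt T' t n) := isLocalRing_thickRing T' (topPt T' t) n
  have e3 : Spec.map (CommRingCat.ofHom (πℂ T' t n).toRingHom) ≫ g'.left = (ptn A₀ hΘ T' t y₀ n n φ).left := by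
    rw [specMap_πℂ]; exact hg'l
  have hptl : (ptn A₀ hΘ T' t y₀ n n φ).left =
      Spec.map (CommRingCat.ofHom φ.toRingHom) ≫ (thickeningPtι (A₀.dualOf Θ hΘ).X y₀ n).left := rfl
  -- the extension is centred at `y₀`
  have hcl : g'.left (IsLocalRing.closedPoint (Rt T' t (n + 1))) = y₀ := by
    haveI : IsLocalHom (CommRingCat.ofHom (πℂ T' t n).toRingHom).hom :=
      isLocalHom_of_thickRing T' (topPt T' t) (n + 1) _
    have h1 : g'.left (IsLocalRing.closedPoint (Rt T' t (n + 1))) =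
        g'.left (Spec.map (CommRingCat.ofHom (πℂ T' t n).toRingHom) (IsLocalRing.closedPoint (Rt T' t n))) := by
      rw [Spec_closedPoint]
    rw [h1]
    have e4 : (Spec.map (CommRingCat.ofHom (πℂ T' t n).toRingHom) ≫ g'.left) (IsLocalRing.closedPoint (Rt T' t n)) =
        y₀ := by
      rw [e3, hptl]
      exact Spec_map_comp_thickeningPtι_closedPoint (A₀.dualOf Θ hΘ).X (topPt (A₀.dualOf Θ hΘ).X y₀) n φ.toRingHom
    exact e4
  have hgK : g'.left ≫ (A₀.dualOf Θ hΘ).X.hom = Spec.map (CommRingCat.ofHom (algebraMap ℂ (Rt T' t (n + 1)))) :=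
    (Over.w g').trans (thickeningPt_hom_eq T' t (n + 1))
  refine ⟨artinianFactor (A₀.dualOf Θ hΘ).X (topPt (A₀.dualOf Θ hΘ).X y₀) g'.left hcl hgK (n + 1)
    (maximalIdeal_thickRing_pow_eq_bot T' (topPt T' t) (n + 1)), ?_⟩
  have hSφ' : Spec.map (CommRingCat.ofHom (artinianFactor (A₀.dualOf Θ hΘ).X (topPt (A₀.dualOf Θ hΘ).X y₀) g'.left
      hcl hgK (n + 1) (maximalIdeal_thickRing_pow_eq_bot T' (topPt T' t) (n + 1))).toRingHom) ≫
      (thickeningPtι (A₀.dualOf Θ hΘ).X y₀ (n + 1)).left = g'.left :=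
    Spec_map_artinianFactor (A₀.dualOf Θ hΘ).X (topPt (A₀.dualOf Θ hΘ).X y₀) g'.left hcl hgK (n + 1) _
  apply algHom_thickRing_ext (A₀.dualOf Θ hΘ).X (topPt (A₀.dualOf Θ hΘ).X y₀) (n + 1)
    (maximalIdeal_thickRing_pow_eq_bot_of_le T' (topPt T' t) (Nat.le_succ n))
  -- both sides have the same `Spec(𝒪_{T,t}/𝔪^{n+1})`-point of `Â`, namely `pt φ`
  have lhs : Spec.map (CommRingCat.ofHom ((πℂ T' t n).comp (artinianFactor (A₀.dualOf Θ hΘ).X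
        (topPt (A₀.dualOf Θ hΘ).X y₀) g'.left hcl hgK (n + 1)
        (maximalIdeal_thickRing_pow_eq_bot T' (topPt T' t) (n + 1)))).toRingHom) ≫
        (thickeningPtι (A₀.dualOf Θ hΘ).X y₀ (n + 1)).left = (ptn A₀ hΘ T' t y₀ n n φ).left := by
    have : CommRingCat.ofHom ((πℂ T' t n).comp (artinianFactor (A₀.dualOf Θ hΘ).X
        (topPt (A₀.dualOf Θ hΘ).X y₀) g'.left hcl hgK (n + 1)
        (maximalIdeal_thickRing_pow_eq_bot T' (topPt T' t) (n + 1)))).toRingHom =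
        CommRingCat.ofHom (artinianFactor (A₀.dualOf Θ hΘ).X (topPt (A₀.dualOf Θ hΘ).X y₀) g'.left hcl hgK
          (n + 1) (maximalIdeal_thickRing_pow_eq_bot T' (topPt T' t) (n + 1))).toRingHom ≫
          CommRingCat.ofHom (πℂ T' t n).toRingHom := rfl
    rw [this]
    erw [Spec.map_comp]
    rw [Category.assoc, hSφ']
    exact e3
  have rhs : Spec.map (CommRingCat.ofHom (φ.comp (πℂ (A₀.dualOf Θ hΘ).X y₀ n)).toRingHom) ≫
      (thickeningPtι (A₀.dualOf Θ hΘ).X y₀ (n + 1)).left = (ptn A₀ hΘ T' t y₀ n n φ).left :=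
    (rfl : _ = (ptn A₀ hΘ T' t y₀ n (n + 1) (φ.comp (πℂ (A₀.dualOf Θ hΘ).X y₀ n))).left).trans
      (congrArg CommaMorphism.left (ptn_comp_β A₀ hΘ T' t y₀ n n φ))
  rw [lhs, rhs]

omit [IsLocallyNoetherian (A₀.dualOf Θ hΘ).X.left] in
/-- **THE LEVEL-INDEXED LIFT MODEL FROM THE THREE REMAINING INPUTS**: given frames `FL`/`FP` of `ℒ|`/`𝒫|` on the Artinian
levels, a framed level-`0` graph point `base`, per-level injectivity of the Kodaira–Spencer maps of the Artinian charts and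
`dim T_{y₀}Â = dim A₀`, there is a `LiftModel₂` of `(A₀, 𝒫, T, ℒ, t)` on the finite affine cover `V` (levels `𝒪_{T,t}/𝔪^{n+1}`,
charts `𝒪_{Â,y₀}/𝔪^{n+1}`; `ModelTower₂.liftModel` of `modelTower`, the `lift` input discharged by `exists_lift_chartPoint`) with
injective Kodaira–Spencer maps and tangent dimension `g` at every level, whose graph predicate at a chart point gives the graph
condition `GraphCond` of the corresponding `T × Â`-valued point of `Spec 𝒪_{T,t}/𝔪^{n+1}`.
[cite: MumfordAV1970, §13 (proof of the Thm. pp. 125–130)] -/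
theorem exists_liftModel₂_of_frames_base [Finite ι] (hcov : iSup V = ⊤)
    (FL : ∀ n, IFrames (Ln A₀ T' ℒ t n) (Wn V n))
    (FP : ∀ n, IFrames (PBn A₀ hΘ P y₀ n) (fun a => (pullback.fst A₀.X.hom (sB A₀ hΘ y₀ n)) ⁻¹ᵁ V a))
    (base : ∃ φ₀ : Rt (A₀.dualOf Θ hΘ).X y₀ 0 →ₐ[ℂ] Rt T' t 0,
      Nonempty ((Scheme.Modules.pullback (gφn A₀ hΘ T' t y₀ 0 0 φ₀)).obj (PBn A₀ hΘ P y₀ 0) ≅ Ln A₀ T' ℒ t 0) ∧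
        (ρℂ T' t ht 0).comp φ₀ = ρℂ (A₀.dualOf Θ hΘ).X y₀ hy₀ 0)
    (hKS : ∀ n, Function.Injective
      (ksLinear ((modelTower A₀ hΘ P T' ℒ t ht V hV y₀ hy₀ hcov
        ⟨FL, FP, base, fun n φ _ => exists_lift_chartPoint A₀ hΘ T' t y₀ n φ⟩).p (n + 1))
        (ρℂ (A₀.dualOf Θ hΘ).X y₀ hy₀ (n + 1))))
    (hdim : ∀ n, FiniteDimensional ℂ (DerAt (ρℂ (A₀.dualOf Θ hΘ).X y₀ hy₀ (n + 1))) ∧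
      Module.finrank ℂ (DerAt (ρℂ (A₀.dualOf Θ hΘ).X y₀ hy₀ (n + 1))) = A₀.dim) :
    ∃ (κ : Type) (_ : Finite κ) (V' : κ → A₀.X.left.Opens) (_ : ∀ i, IsAffineOpen (V' i)) (_ : iSup V' = ⊤)
      (M : LiftModel₂ A₀.X.hom V'),
      (∀ n, Function.Injective (ksLinear (M.p (n + 1)) (M.ev (n + 1)))) ∧
      (∀ n, FiniteDimensional ℂ (DerAt (M.ev (n + 1))) ∧ Module.finrank ℂ (DerAt (M.ev (n + 1))) = A₀.dim) ∧
      ∀ n (φ : M.B n →ₐ[ℂ] M.R n), M.Graph n φ →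
        ∃ g : thickeningPt T' t n ⟶ (A₀.dualOf Θ hΘ).X,
          GraphCond A₀ hΘ P T' ℒ (CartesianMonoidalCategory.lift (thickeningPtι T' t n) g) :=
  ⟨ι, inferInstance, V, hV, hcov,
    (modelTower A₀ hΘ P T' ℒ t ht V hV y₀ hy₀ hcov ⟨FL, FP, base, fun n φ _ => exists_lift_chartPoint A₀ hΘ T' t y₀ n φ⟩).liftModel,
    hKS, hdim, fun n φ hφ => ⟨ptn A₀ hΘ T' t y₀ n n φ, graphCond_of_iso A₀ hΘ P T' ℒ t y₀ n n φ (Classical.choice hφ.1)⟩⟩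

end GammaInstance

end Literature.AlgebraicGeometry.Motives.AbelianVariety

end
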